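import Summits.AtomisticToContinuum.HydrodynamicLimit.Theorems.CollisionIsometryCLTAdaptedWeightCLTCBEqRungGauss

/-!
# Equilibrium rung of the crux `AdaptedWeightCLT` (stmt-AtomisticToContinuum-14868), line `Sketch`:
# the block functional of a centred test under independent Gaussian velocities

Support file (`--supports stmt-AtomisticToContinuum-14868`, anchor `eqRung_core_anchor`) of the line lead
`prover-line-stmt-AtomisticToContinuum-14868-c3-0`; second file of the EQUILIBRIUM RUNG (see
`…CBEqRungGauss.lean` for the one-particle inputs). Under the product law `⊗ᵢ N(u, θ𝟙)` of `N + 1`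
independent velocities (the local Gibbs velocities given the positions, at constant profiles) and for
convex block weights `c` (`cᵢ ≥ 0`, `Σ cᵢ = 1`, `s = Σ cᵢ²`), the block functional of a continuous test
`f` of degree `k + 1` (`|f y| ≤ 2‖y‖^{k+1}`, `|f y' − f y| ≤ 2‖y' − y‖(‖y'‖ + ‖y‖)^k`, centred under
`N(0, θ𝟙)`) is `F(v) = Σᵢ cᵢ f(ζᵢ − η)`, `ζᵢ = vᵢ − u`, `η = Σ cᵢ ζᵢ` (block velocity minus `u`); the crux's
block traceless stress is `(W/M)·F` for `f = ⟨C2 j l, ·⊗·⟩` (`k = 1`) and its block heat flux for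
`f = ⟨C3 a, ·^{⊗3}⟩` (`k = 2`). MAIN RESULT (`lintegral_coreF_sq_le`):

  `E F² ≤ 8 m_{2k+2} s + 32·9^k ((3θ s)^{1/2} m₆^{1/2})^{1/2} m_{4k}^{1/2}`,   `m_n = ∫ ‖v − u‖^n dN(u, θ𝟙)`,

which is `O(s^{1/4})`. Proof: `F = F₀ + R` with `F₀ = Σ cᵢ f(ζᵢ)`; `E F₀² = Σ cᵢ² Var f(ζ) ≤ 4 m_{2k+2} s`
(Mathlib `variance_sum_pi`: variance of a sum of independent variables); `|R| ≤ 4·3^k ‖η‖ P_k` with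
`P_n = Σ cᵢ ‖ζᵢ‖^n` (Lipschitz bound, `‖η‖ ≤ P₁`, Jensen `P₁^k ≤ P_k`); `E ‖η‖² = 3θ s` (variance of a sum
again, coordinatewise), `E ‖η‖⁶ ≤ E P₆ = m₆`, two Cauchy–Schwarz steps. All expectations are lower
Lebesgue integrals; the block objects `η`, `P`, `F`, `F₀` enter as function arguments WITH THEIR DEFINING
EQUATIONS as hypotheses (no definitions are introduced: pure proof file), to be instantiated by `rfl`.

References: H. Spohn, *Large Scale Dynamics of Interacting Particles* (1991), Part I §2.3 [Spohn1991].
-/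

namespace Summit.AtomisticToContinuum.HydrodynamicLimit.Theorems.ContactBalance

open scoped BigOperators Topology Classical MeasureTheory ENNReal InnerProductSpace
open Filter Set MeasureTheory ProbabilityTheory
open Literature.Analysis.FluidPDE
open Summit.AtomisticToContinuum.HydrodynamicLimit.Theorems.ContactSourceDuhamel
open Summit.AtomisticToContinuum.HydrodynamicLimit.Theorems.ContactSourceDuhamel.TimeLocal
open Literature.MathematicalPhysics.KineticTheory (gaussMeasure integral_gaussMeasure
  variance_coord_gaussMeasure integral_coord_gaussMeasure memLp_coord_gaussMeasure)

noncomputable section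

namespace EqRung

variable (u : V3) (θ : ℝ) {N : ℕ}

variable (c : Fin (N + 1) → ℝ)


/-! ## The block velocity fluctuation `η = Σᵢ cᵢ (vᵢ − u)` -/

section Eta

variable (η : (Fin (N + 1) → V3) → V3)

/-- `‖η‖ ≤ P₁ = Σ cᵢ ‖vᵢ − u‖`. -/
theorem norm_eta_le (hc0 : ∀ i, 0 ≤ c i) (hη : η = fun v => ∑ i, c i • (v i - u)) (v : Fin (N + 1) → V3) :
    ‖η v‖ ≤ ∑ i, c i * ‖v i - u‖ ^ 1 := by
  subst hη
  refine (norm_sum_le _ _).trans (Finset.sum_le_sum fun i _ => ?_)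
  rw [norm_smul, Real.norm_of_nonneg (hc0 i), pow_one]

/-- The coordinates of `η`: `η_b = Σᵢ cᵢ (vᵢ − u)_b`. -/
theorem eta_apply (hη : η = fun v => ∑ i, c i • (v i - u)) (b : Fin 3) (v : Fin (N + 1) → V3) :
    η v b = ∑ i, c i * (v i - u) b := by
  subst hη
  simp only [WithLp.ofLp_sum, Finset.sum_apply, WithLp.ofLp_smul, Pi.smul_apply, smul_eq_mul]

/-- `E ‖η‖^n ≤ m_n` for convex weights (`‖η‖ ≤ P₁`, Jensen, linearity). -/
theorem lintegral_norm_eta_pow_le (hc0 : ∀ i, 0 ≤ c i) (hc1 : ∑ i, c i = 1)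
    (hη : η = fun v => ∑ i, c i • (v i - u)) (n : ℕ) :
    ∫⁻ v, ENNReal.ofReal (‖η v‖ ^ n) ∂(Measure.pi (fun _ : Fin (N + 1) => gaussMeasure u θ)) ≤ ENNReal.ofReal (∫ w, ‖w - u‖ ^ n ∂gaussMeasure u θ) := by
  set P : ℕ → (Fin (N + 1) → V3) → ℝ := fun m v => ∑ i, c i * ‖v i - u‖ ^ m with hP
  calc ∫⁻ v, ENNReal.ofReal (‖η v‖ ^ n) ∂(Measure.pi (fun _ : Fin (N + 1) => gaussMeasure u θ)) ≤ ∫⁻ v, ENNReal.ofReal (P 1 v ^ n) ∂(Measure.pi (fun _ : Fin (N + 1) => gaussMeasure u θ)) :=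
        lintegral_mono fun v => ENNReal.ofReal_le_ofReal
          (pow_le_pow_left₀ (norm_nonneg _) (norm_eta_le u c η hc0 hη v) n)
    _ ≤ ENNReal.ofReal (∫ w, ‖w - u‖ ^ (1 * n) ∂gaussMeasure u θ) := lintegral_P_pow_le u θ c P hc0 hc1 hP 1 n
    _ = _ := by rw [one_mul]

/-- `E ‖η‖² = 3 θ Σ cᵢ²` (independence, coordinatewise: variance of a sum of independent centred
Gaussians), as a lower integral. -/
theorem lintegral_norm_eta_sq (hη : η = fun v => ∑ i, c i • (v i - u)) (hθ : 0 < θ) :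
    ∫⁻ v, ENNReal.ofReal (‖η v‖ ^ 2) ∂(Measure.pi (fun _ : Fin (N + 1) => gaussMeasure u θ)) = ENNReal.ofReal (3 * θ * ∑ i, c i ^ 2) := by
  -- each coordinate summand is square integrable, centred, with variance `cᵢ² θ`
  have hcoordfun : ∀ b : Fin 3, (fun w : V3 => (w - u) b) = fun w => w b + -(u b) := by
    intro b; funext w; simp [sub_eq_add_neg]
  have hX : ∀ (b : Fin 3) (i : Fin (N + 1)),
      MemLp (fun w : V3 => c i * (w - u) b) 2 (gaussMeasure u θ) := by
    intro b i
    have h1 : MemLp (fun w : V3 => (w - u) b) 2 (gaussMeasure u θ) := by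
      rw [hcoordfun b]
      exact (memLp_coord_gaussMeasure u θ b 2 (by simp)).add (memLp_const _)
    exact h1.const_mul _
  have hmean : ∀ (b : Fin 3) (i : Fin (N + 1)), ∫ w, c i * (w - u) b ∂gaussMeasure u θ = 0 := by
    intro b i
    rw [integral_const_mul, hcoordfun b,
      integral_add ((memLp_coord_gaussMeasure u θ b 1 (by simp)).integrable le_rfl) (integrable_const _),
      integral_coord_gaussMeasure u hθ, integral_const]
    simp
  have hvar1 : ∀ (b : Fin 3) (i : Fin (N + 1)),
      Var[fun w : V3 => c i * (w - u) b; gaussMeasure u θ] = c i ^ 2 * θ := by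
    intro b i
    rw [variance_const_mul, hcoordfun b,
      variance_add_const (memLp_coord_gaussMeasure u θ b 2 (by simp)).aestronglyMeasurable,
      variance_coord_gaussMeasure u hθ.le]
  have hXi : ∀ (b : Fin 3) (i : Fin (N + 1)),
      MemLp (fun v : Fin (N + 1) → V3 => c i * (v i - u) b) 2 (Measure.pi (fun _ : Fin (N + 1) => gaussMeasure u θ)) := fun b i =>
    (hX b i).comp_measurePreserving (measurePreserving_eval (fun _ : Fin (N + 1) => gaussMeasure u θ) i)
  -- second moment of one coordinate of `η`
  have hsq : ∀ b : Fin 3, ∫ v, η v b ^ 2 ∂(Measure.pi (fun _ : Fin (N + 1) => gaussMeasure u θ)) = θ * ∑ i, c i ^ 2 := by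
    intro b
    have hS : MemLp (fun v : Fin (N + 1) → V3 => ∑ i, c i * (v i - u) b) 2 (Measure.pi (fun _ : Fin (N + 1) => gaussMeasure u θ)) :=
      memLp_finsetSum Finset.univ fun i _ => hXi b i
    have hm : ∫ v, (∑ i, c i * (v i - u) b) ∂(Measure.pi (fun _ : Fin (N + 1) => gaussMeasure u θ)) = 0 := by
      rw [integral_finsetSum Finset.univ (f := fun i (v : Fin (N + 1) → V3) => c i * (v i - u) b)
        fun i _ => (hXi b i).integrable one_le_two]
      refine Finset.sum_eq_zero fun i _ => ?_
      have h := (measurePreserving_eval (fun _ : Fin (N + 1) => gaussMeasure u θ) i).map_eq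
      have hint := integral_map (μ := (Measure.pi (fun _ : Fin (N + 1) => gaussMeasure u θ))) (measurable_pi_apply i).aemeasurable
        (f := fun w : V3 => c i * (w - u) b) (by rw [h]; exact (hX b i).aestronglyMeasurable)
      rw [h] at hint
      calc ∫ v, c i * (v i - u) b ∂(Measure.pi (fun _ : Fin (N + 1) => gaussMeasure u θ)) = ∫ w, c i * (w - u) b ∂gaussMeasure u θ := hint.symm
        _ = 0 := hmean b i
    have hv : Var[fun v : Fin (N + 1) → V3 => ∑ i, c i * (v i - u) b; (Measure.pi (fun _ : Fin (N + 1) => gaussMeasure u θ))] = θ * ∑ i, c i ^ 2 := by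
      have := variance_sum_pi (μ := fun _ : Fin (N + 1) => gaussMeasure u θ)
        (X := fun i (w : V3) => c i * (w - u) b) (fun i => hX b i)
      have hfun : (∑ i, fun v : Fin (N + 1) → V3 => c i * (v i - u) b) =
          fun v => ∑ i, c i * (v i - u) b := by
        funext v; simp
      rw [hfun] at this
      rw [this]
      simp_rw [hvar1 b, Finset.mul_sum]
      exact Finset.sum_congr rfl fun i _ => by ring
    have h2 := variance_eq_sub hS
    simp only [Pi.pow_apply] at h2
    rw [hv, hm] at h2
    simp only [ne_eq, OfNat.ofNat_ne_zero, not_false_eq_true, zero_pow, sub_zero] at h2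
    simp_rw [eta_apply u c η hη b]
    exact h2.symm
  -- integrability of the squared coordinates and assembly
  have hint : ∀ b : Fin 3, Integrable (fun v : Fin (N + 1) → V3 => η v b ^ 2) (Measure.pi (fun _ : Fin (N + 1) => gaussMeasure u θ)) := by
    intro b
    have hS : MemLp (fun v : Fin (N + 1) → V3 => ∑ i, c i * (v i - u) b) 2 (Measure.pi (fun _ : Fin (N + 1) => gaussMeasure u θ)) :=
      memLp_finsetSum Finset.univ fun i _ => hXi b i
    refine hS.integrable_sq.congr (ae_of_all _ fun v => ?_)
    simp only [eta_apply u c η hη b]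
  have hnsq : ∀ v : Fin (N + 1) → V3, ‖η v‖ ^ 2 = ∑ b : Fin 3, η v b ^ 2 := fun v => by
    rw [EuclideanSpace.real_norm_sq_eq]
  simp_rw [hnsq]
  rw [← ofReal_integral_eq_lintegral_ofReal (integrable_finsetSum _ fun b _ => hint b)
    (ae_of_all _ fun v => Finset.sum_nonneg fun b _ => sq_nonneg _),
    integral_finsetSum _ fun b _ => hint b]
  simp_rw [hsq]
  simp only [Finset.sum_const, Finset.card_univ, Fintype.card_fin, nsmul_eq_mul, Nat.cast_ofNat]
  ring_nf

/-- `E ‖η‖⁴ ≤ (3 θ s)^{1/2} m₆^{1/2}`, `s = Σ cᵢ²` (Cauchy–Schwarz with `‖η‖ · ‖η‖³`). -/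
theorem lintegral_norm_eta_four_le (hc0 : ∀ i, 0 ≤ c i) (hc1 : ∑ i, c i = 1)
    (hη : η = fun v => ∑ i, c i • (v i - u)) (hθ : 0 < θ) :
    ∫⁻ v, ENNReal.ofReal (‖η v‖ ^ 4) ∂(Measure.pi (fun _ : Fin (N + 1) => gaussMeasure u θ)) ≤
      ENNReal.ofReal (3 * θ * ∑ i, c i ^ 2) ^ (1 / 2 : ℝ) *
        ENNReal.ofReal (∫ w, ‖w - u‖ ^ 6 ∂gaussMeasure u θ) ^ (1 / 2 : ℝ) := by
  have hcη : Continuous η := by rw [hη]; fun_prop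
  have hm : Measurable fun v : Fin (N + 1) → V3 => ‖η v‖ := hcη.measurable.norm
  have hm3 : Measurable fun v : Fin (N + 1) → V3 => ‖η v‖ ^ 3 := hm.pow_const 3
  calc ∫⁻ v, ENNReal.ofReal (‖η v‖ ^ 4) ∂(Measure.pi (fun _ : Fin (N + 1) => gaussMeasure u θ))
      = ∫⁻ v, ENNReal.ofReal (‖η v‖ * ‖η v‖ ^ 3) ∂(Measure.pi (fun _ : Fin (N + 1) => gaussMeasure u θ)) := by
        refine lintegral_congr fun v => ?_; ring_nf
    _ ≤ (∫⁻ v, ENNReal.ofReal (‖η v‖ ^ 2) ∂(Measure.pi (fun _ : Fin (N + 1) => gaussMeasure u θ))) ^ (1 / 2 : ℝ) *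
          (∫⁻ v, ENNReal.ofReal ((‖η v‖ ^ 3) ^ 2) ∂(Measure.pi (fun _ : Fin (N + 1) => gaussMeasure u θ))) ^ (1 / 2 : ℝ) :=
        lintegral_ofReal_mul_le _ hm hm3 (fun v => norm_nonneg _) (fun v => by positivity)
    _ ≤ _ := by
        rw [lintegral_norm_eta_sq u θ c η hη hθ]
        gcongr
        calc ∫⁻ v, ENNReal.ofReal ((‖η v‖ ^ 3) ^ 2) ∂(Measure.pi (fun _ : Fin (N + 1) => gaussMeasure u θ)) = ∫⁻ v, ENNReal.ofReal (‖η v‖ ^ 6) ∂(Measure.pi (fun _ : Fin (N + 1) => gaussMeasure u θ)) := by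
              refine lintegral_congr fun v => ?_; rw [← pow_mul]
          _ ≤ _ := lintegral_norm_eta_pow_le u θ c η hc0 hc1 hη 6

/-- `E ‖η‖² P_k² ≤ ((3θ s)^{1/2} m₆^{1/2})^{1/2} m_{4k}^{1/2}` (Cauchy–Schwarz, Jensen). -/
theorem lintegral_eta_sq_P_sq_le (P : ℕ → (Fin (N + 1) → V3) → ℝ) (hc0 : ∀ i, 0 ≤ c i) (hc1 : ∑ i, c i = 1)
    (hη : η = fun v => ∑ i, c i • (v i - u)) (hP : P = fun m v => ∑ i, c i * ‖v i - u‖ ^ m)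
    (hθ : 0 < θ) (k : ℕ) :
    ∫⁻ v, ENNReal.ofReal (‖η v‖ ^ 2 * P k v ^ 2) ∂(Measure.pi (fun _ : Fin (N + 1) => gaussMeasure u θ)) ≤
      (ENNReal.ofReal (3 * θ * ∑ i, c i ^ 2) ^ (1 / 2 : ℝ) *
          ENNReal.ofReal (∫ w, ‖w - u‖ ^ 6 ∂gaussMeasure u θ) ^ (1 / 2 : ℝ)) ^ (1 / 2 : ℝ) *
        ENNReal.ofReal (∫ w, ‖w - u‖ ^ (k * 4) ∂gaussMeasure u θ) ^ (1 / 2 : ℝ) := by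
  have hcη : Continuous η := by rw [hη]; fun_prop
  have hm : Measurable fun v : Fin (N + 1) → V3 => ‖η v‖ ^ 2 := hcη.measurable.norm.pow_const 2
  have hPm : Measurable fun v : Fin (N + 1) → V3 => P k v ^ 2 :=
    (continuous_P u c P hP k).measurable.pow_const 2
  calc ∫⁻ v, ENNReal.ofReal (‖η v‖ ^ 2 * P k v ^ 2) ∂(Measure.pi (fun _ : Fin (N + 1) => gaussMeasure u θ))
      ≤ (∫⁻ v, ENNReal.ofReal ((‖η v‖ ^ 2) ^ 2) ∂(Measure.pi (fun _ : Fin (N + 1) => gaussMeasure u θ))) ^ (1 / 2 : ℝ) *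
          (∫⁻ v, ENNReal.ofReal ((P k v ^ 2) ^ 2) ∂(Measure.pi (fun _ : Fin (N + 1) => gaussMeasure u θ))) ^ (1 / 2 : ℝ) :=
        lintegral_ofReal_mul_le _ hm hPm (fun v => by positivity) (fun v => sq_nonneg _)
    _ ≤ _ := by
        gcongr
        · calc ∫⁻ v, ENNReal.ofReal ((‖η v‖ ^ 2) ^ 2) ∂(Measure.pi (fun _ : Fin (N + 1) => gaussMeasure u θ)) = ∫⁻ v, ENNReal.ofReal (‖η v‖ ^ 4) ∂(Measure.pi (fun _ : Fin (N + 1) => gaussMeasure u θ)) := by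
                refine lintegral_congr fun v => ?_; rw [← pow_mul]
            _ ≤ _ := lintegral_norm_eta_four_le u θ c η hc0 hc1 hη hθ
        · calc ∫⁻ v, ENNReal.ofReal ((P k v ^ 2) ^ 2) ∂(Measure.pi (fun _ : Fin (N + 1) => gaussMeasure u θ)) = ∫⁻ v, ENNReal.ofReal (P k v ^ 4) ∂(Measure.pi (fun _ : Fin (N + 1) => gaussMeasure u θ)) := by
                refine lintegral_congr fun v => ?_; rw [← pow_mul]
            _ ≤ _ := lintegral_P_pow_le u θ c P hc0 hc1 hP k 4

end Eta

/-! ## The block functional of a centred test: `F = Σ cᵢ f(ζᵢ − η)`, `F₀ = Σ cᵢ f(ζᵢ)` -/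

section Core

variable {f : V3 → ℝ} (η : (Fin (N + 1) → V3) → V3) (P : ℕ → (Fin (N + 1) → V3) → ℝ)
  (F F0 : (Fin (N + 1) → V3) → ℝ)

/-- The Lipschitz remainder: `|F − F₀| ≤ 4·3^k ‖η‖ P_k`. -/
theorem abs_F_sub_F0_le (hc0 : ∀ i, 0 ≤ c i) (hc1 : ∑ i, c i = 1)
    (hη : η = fun v => ∑ i, c i • (v i - u)) (hP : P = fun m v => ∑ i, c i * ‖v i - u‖ ^ m)
    (hF : F = fun v => ∑ i, c i * f (v i - u - η v)) (hF0 : F0 = fun v => ∑ i, c i * f (v i - u)) {k : ℕ}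
    (hf1 : ∀ y y', |f y' - f y| ≤ 2 * ‖y' - y‖ * (‖y'‖ + ‖y‖) ^ k) (v : Fin (N + 1) → V3) :
    |F v - F0 v| ≤ 4 * 3 ^ k * ‖η v‖ * P k v := by
  have hηle := norm_eta_le u c η hc0 hη v
  have hPv : ∀ m, P m v = ∑ i, c i * ‖v i - u‖ ^ m := fun m => by rw [hP]
  -- termwise Lipschitz bound
  have hterm : ∀ i, |c i * f (v i - u - η v) - c i * f (v i - u)| ≤
      c i * (2 * ‖η v‖ * (3 ^ k * (‖v i - u‖ ^ k + ‖η v‖ ^ k))) := by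
    intro i
    rw [← mul_sub, abs_mul, abs_of_nonneg (hc0 i)]
    refine mul_le_mul_of_nonneg_left ?_ (hc0 i)
    have h1 := hf1 (v i - u) (v i - u - η v)
    have hd : ‖v i - u - η v - (v i - u)‖ = ‖η v‖ := by rw [sub_sub_cancel_left, norm_neg]
    rw [hd] at h1
    refine h1.trans (mul_le_mul_of_nonneg_left ?_ (by positivity))
    have h2 : ‖v i - u - η v‖ + ‖v i - u‖ ≤ 2 * ‖v i - u‖ + ‖η v‖ := by
      linarith [norm_sub_le (v i - u) (η v)]
    set a := ‖v i - u‖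
    set b := ‖η v‖
    have ha : 0 ≤ a := norm_nonneg _
    have hb : 0 ≤ b := norm_nonneg _
    have h3 : (2 * a + b) ^ k ≤ 3 ^ k * (a ^ k + b ^ k) := by
      rcases le_total a b with hab | hab
      · calc (2 * a + b) ^ k ≤ (3 * b) ^ k := pow_le_pow_left₀ (by positivity) (by linarith) k
          _ = 3 ^ k * b ^ k := mul_pow 3 b k
          _ ≤ 3 ^ k * (a ^ k + b ^ k) := by
              refine mul_le_mul_of_nonneg_left ?_ (by positivity); linarith [pow_nonneg ha k]
      · calc (2 * a + b) ^ k ≤ (3 * a) ^ k := pow_le_pow_left₀ (by positivity) (by linarith) k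
          _ = 3 ^ k * a ^ k := mul_pow 3 a k
          _ ≤ 3 ^ k * (a ^ k + b ^ k) := by
              refine mul_le_mul_of_nonneg_left ?_ (by positivity); linarith [pow_nonneg hb k]
    have h0 : 0 ≤ ‖v i - u - η v‖ + a := by positivity
    exact (pow_le_pow_left₀ h0 h2 k).trans h3
  -- sum up
  have hsum : |F v - F0 v| ≤ ∑ i, c i * (2 * ‖η v‖ * (3 ^ k * (‖v i - u‖ ^ k + ‖η v‖ ^ k))) := by
    rw [hF, hF0]
    dsimp only
    rw [← Finset.sum_sub_distrib]
    exact (Finset.abs_sum_le_sum_abs _ _).trans (Finset.sum_le_sum fun i _ => hterm i)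
  refine hsum.trans ?_
  -- `Σ cᵢ (‖ζᵢ‖^k + ‖η‖^k) = P_k + ‖η‖^k ≤ 2 P_k`
  have hS : ∑ i, c i * (2 * ‖η v‖ * (3 ^ k * (‖v i - u‖ ^ k + ‖η v‖ ^ k))) =
      2 * ‖η v‖ * 3 ^ k * (P k v + (∑ i, c i) * ‖η v‖ ^ k) := by
    rw [hPv, Finset.sum_mul, ← Finset.sum_add_distrib, Finset.mul_sum]
    exact Finset.sum_congr rfl fun i _ => by ring
  rw [hS, hc1, one_mul]
  have hηk : ‖η v‖ ^ k ≤ P k v :=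
    calc ‖η v‖ ^ k ≤ P 1 v ^ k := by
          rw [hPv 1]; exact pow_le_pow_left₀ (norm_nonneg _) hηle k
      _ ≤ P (1 * k) v := P_pow_le u c P hc0 hc1 hP 1 k v
      _ = P k v := by rw [one_mul]
  have hb : 0 ≤ ‖η v‖ := norm_nonneg _
  have h3k : (0 : ℝ) ≤ 3 ^ k := by positivity
  nlinarith [mul_nonneg (mul_nonneg hb h3k) (sub_nonneg.2 hηk)]

/-- `E F₀² = Σ cᵢ² Var f(ζ) ≤ 4 m_{2k+2} Σ cᵢ²` (variance of a sum of independent centred variables). -/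
theorem lintegral_F0_sq_le (hF0 : F0 = fun v => ∑ i, c i * f (v i - u)) (hf : Continuous f) {k : ℕ}
    (hf0 : ∀ y, |f y| ≤ 2 * ‖y‖ ^ (k + 1)) (hmean : ∫ w, f (w - u) ∂gaussMeasure u θ = 0) :
    ∫⁻ v, ENNReal.ofReal (F0 v ^ 2) ∂(Measure.pi (fun _ : Fin (N + 1) => gaussMeasure u θ)) ≤
      ENNReal.ofReal (4 * (∫ w, ‖w - u‖ ^ (2 * (k + 1)) ∂gaussMeasure u θ) * ∑ i, c i ^ 2) := by
  have h2 : MemLp (fun w : V3 => f (w - u)) 2 (gaussMeasure u θ) := memLp_two_f_sub u hf hf0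
  have hX : ∀ i : Fin (N + 1), MemLp (fun w : V3 => c i * f (w - u)) 2 (gaussMeasure u θ) :=
    fun i => h2.const_mul _
  have hXi : ∀ i : Fin (N + 1), MemLp (fun v : Fin (N + 1) → V3 => c i * f (v i - u)) 2 (Measure.pi (fun _ : Fin (N + 1) => gaussMeasure u θ)) :=
    fun i => (hX i).comp_measurePreserving (measurePreserving_eval (fun _ : Fin (N + 1) => gaussMeasure u θ) i)
  have hS : MemLp F0 2 (Measure.pi (fun _ : Fin (N + 1) => gaussMeasure u θ)) := by
    rw [hF0]
    exact memLp_finsetSum Finset.univ fun i _ => hXi i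
  -- mean zero
  have hm : ∫ v, F0 v ∂(Measure.pi (fun _ : Fin (N + 1) => gaussMeasure u θ)) = 0 := by
    rw [hF0, integral_finsetSum Finset.univ (f := fun i (v : Fin (N + 1) → V3) => c i * f (v i - u))
      fun i _ => (hXi i).integrable one_le_two]
    refine Finset.sum_eq_zero fun i _ => ?_
    have h := (measurePreserving_eval (fun _ : Fin (N + 1) => gaussMeasure u θ) i).map_eq
    have hint := integral_map (μ := (Measure.pi (fun _ : Fin (N + 1) => gaussMeasure u θ))) (measurable_pi_apply i).aemeasurable
      (f := fun w : V3 => c i * f (w - u)) (by rw [h]; exact (hX i).aestronglyMeasurable)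
    rw [h] at hint
    calc ∫ v, c i * f (v i - u) ∂(Measure.pi (fun _ : Fin (N + 1) => gaussMeasure u θ)) = ∫ w, c i * f (w - u) ∂gaussMeasure u θ := hint.symm
      _ = 0 := by rw [integral_const_mul, hmean, mul_zero]
  have hvi := variance_f_sub_le u hf hf0 hmean
  -- variance of the sum
  have hv : Var[F0; (Measure.pi (fun _ : Fin (N + 1) => gaussMeasure u θ))] ≤ 4 * (∫ w, ‖w - u‖ ^ (2 * (k + 1)) ∂gaussMeasure u θ) * ∑ i, c i ^ 2 := by
    have := variance_sum_pi (μ := fun _ : Fin (N + 1) => gaussMeasure u θ)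
      (X := fun i (w : V3) => c i * f (w - u)) hX
    have hfun : (∑ i, fun v : Fin (N + 1) → V3 => c i * f (v i - u)) = F0 := by
      rw [hF0]; funext v; simp
    rw [hfun] at this
    rw [this]
    simp_rw [variance_const_mul]
    rw [Finset.mul_sum]
    refine Finset.sum_le_sum fun i _ => ?_
    calc c i ^ 2 * Var[fun w : V3 => f (w - u); gaussMeasure u θ]
        ≤ c i ^ 2 * (4 * ∫ w, ‖w - u‖ ^ (2 * (k + 1)) ∂gaussMeasure u θ) :=
          mul_le_mul_of_nonneg_left hvi (sq_nonneg _)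
      _ = _ := by ring
  have h2m := variance_eq_sub hS
  simp only [Pi.pow_apply] at h2m
  rw [hm] at h2m
  simp only [ne_eq, OfNat.ofNat_ne_zero, not_false_eq_true, zero_pow, sub_zero] at h2m
  rw [← ofReal_integral_eq_lintegral_ofReal hS.integrable_sq (ae_of_all _ fun v => sq_nonneg _)]
  refine ENNReal.ofReal_le_ofReal ?_
  calc ∫ v, F0 v ^ 2 ∂(Measure.pi (fun _ : Fin (N + 1) => gaussMeasure u θ)) = Var[F0; (Measure.pi (fun _ : Fin (N + 1) => gaussMeasure u θ))] := h2m.symm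
    _ ≤ _ := hv

/-- **The core bound.** For convex weights and a centred continuous test of degree `k + 1`:
`E F² ≤ 8 m_{2k+2} s + 32·9^k ((3θ s)^{1/2} m₆^{1/2})^{1/2} m_{4k}^{1/2}`, `s = Σ cᵢ²`,
`m_n = ∫ ‖w − u‖^n dN(u, θ𝟙)`. -/
theorem lintegral_F_sq_le (hc0 : ∀ i, 0 ≤ c i) (hc1 : ∑ i, c i = 1)
    (hη : η = fun v => ∑ i, c i • (v i - u)) (hP : P = fun m v => ∑ i, c i * ‖v i - u‖ ^ m)
    (hF : F = fun v => ∑ i, c i * f (v i - u - η v)) (hF0 : F0 = fun v => ∑ i, c i * f (v i - u))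
    (hf : Continuous f) {k : ℕ} (hf0 : ∀ y, |f y| ≤ 2 * ‖y‖ ^ (k + 1))
    (hf1 : ∀ y y', |f y' - f y| ≤ 2 * ‖y' - y‖ * (‖y'‖ + ‖y‖) ^ k)
    (hθ : 0 < θ) (hmean : ∫ w, f (w - u) ∂gaussMeasure u θ = 0) :
    ∫⁻ v, ENNReal.ofReal (F v ^ 2) ∂(Measure.pi (fun _ : Fin (N + 1) => gaussMeasure u θ)) ≤
      2 * ENNReal.ofReal (4 * (∫ w, ‖w - u‖ ^ (2 * (k + 1)) ∂gaussMeasure u θ) * ∑ i, c i ^ 2) +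
        2 * (ENNReal.ofReal (16 * 9 ^ k) *
          ((ENNReal.ofReal (3 * θ * ∑ i, c i ^ 2) ^ (1 / 2 : ℝ) *
              ENNReal.ofReal (∫ w, ‖w - u‖ ^ 6 ∂gaussMeasure u θ) ^ (1 / 2 : ℝ)) ^ (1 / 2 : ℝ) *
            ENNReal.ofReal (∫ w, ‖w - u‖ ^ (k * 4) ∂gaussMeasure u θ) ^ (1 / 2 : ℝ))) := by
  have hcη : Continuous η := by rw [hη]; fun_prop
  have hcF0 : Continuous F0 := by rw [hF0]; fun_prop
  -- pointwise: `F² ≤ 2 F₀² + 2 (4·3^k ‖η‖ P_k)²`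
  have e9 : (9 : ℝ) ^ k = (3 ^ k) ^ 2 := by
    calc (9 : ℝ) ^ k = ((3 : ℝ) ^ 2) ^ k := by norm_num
      _ = (3 : ℝ) ^ (2 * k) := (pow_mul 3 2 k).symm
      _ = (3 : ℝ) ^ (k * 2) := by rw [mul_comm]
      _ = ((3 : ℝ) ^ k) ^ 2 := pow_mul 3 k 2
  have hpt : ∀ v : Fin (N + 1) → V3, F v ^ 2 ≤
      2 * F0 v ^ 2 + 2 * (16 * 9 ^ k * (‖η v‖ ^ 2 * P k v ^ 2)) := by
    intro v
    have hR := abs_F_sub_F0_le u c η P F F0 hc0 hc1 hη hP hF hF0 hf1 v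
    have hR2 : (F v - F0 v) ^ 2 ≤ (4 * 3 ^ k * ‖η v‖ * P k v) ^ 2 := by
      rw [← sq_abs]; exact pow_le_pow_left₀ (abs_nonneg _) hR 2
    have halg : (4 * 3 ^ k * ‖η v‖ * P k v) ^ 2 = 16 * 9 ^ k * (‖η v‖ ^ 2 * P k v ^ 2) := by
      rw [e9]; ring
    rw [halg] at hR2
    nlinarith [sq_nonneg (F0 v - (F v - F0 v)), hR2]
  have hmF0 : Measurable fun v : Fin (N + 1) → V3 => ENNReal.ofReal (F0 v ^ 2) :=
    (hcF0.pow 2).measurable.ennreal_ofReal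
  have hmR : Measurable fun v : Fin (N + 1) → V3 => ENNReal.ofReal (‖η v‖ ^ 2 * P k v ^ 2) :=
    ((hcη.measurable.norm.pow_const 2).mul ((continuous_P u c P hP k).measurable.pow_const 2)).ennreal_ofReal
  calc ∫⁻ v, ENNReal.ofReal (F v ^ 2) ∂(Measure.pi (fun _ : Fin (N + 1) => gaussMeasure u θ))
      ≤ ∫⁻ v, (2 * ENNReal.ofReal (F0 v ^ 2) +
          2 * (ENNReal.ofReal (16 * 9 ^ k) * ENNReal.ofReal (‖η v‖ ^ 2 * P k v ^ 2))) ∂(Measure.pi (fun _ : Fin (N + 1) => gaussMeasure u θ)) := by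
        refine lintegral_mono fun v => ?_
        have h1 : (0 : ℝ) ≤ 16 * 9 ^ k * (‖η v‖ ^ 2 * P k v ^ 2) := by positivity
        calc ENNReal.ofReal (F v ^ 2)
            ≤ ENNReal.ofReal (2 * F0 v ^ 2 + 2 * (16 * 9 ^ k * (‖η v‖ ^ 2 * P k v ^ 2))) :=
              ENNReal.ofReal_le_ofReal (hpt v)
          _ = _ := by
              rw [ENNReal.ofReal_add (by positivity) (by positivity), ENNReal.ofReal_mul zero_le_two,
                ENNReal.ofReal_mul zero_le_two, ENNReal.ofReal_mul (by positivity), ENNReal.ofReal_ofNat]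
    _ = 2 * ∫⁻ v, ENNReal.ofReal (F0 v ^ 2) ∂(Measure.pi (fun _ : Fin (N + 1) => gaussMeasure u θ)) +
          2 * (ENNReal.ofReal (16 * 9 ^ k) * ∫⁻ v, ENNReal.ofReal (‖η v‖ ^ 2 * P k v ^ 2) ∂(Measure.pi (fun _ : Fin (N + 1) => gaussMeasure u θ))) := by
        rw [lintegral_add_left (hmF0.const_mul _), lintegral_const_mul _ hmF0,
          lintegral_const_mul _ (hmR.const_mul _), lintegral_const_mul _ hmR]
    _ ≤ _ := by
        gcongr
        · exact lintegral_F0_sq_le u θ c F0 hF0 hf hf0 hmean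
        · exact lintegral_eta_sq_P_sq_le u θ c η P hc0 hc1 hη hP hθ k

end Core

/-! ## Registered anchor of this support file -/

/-- ANCHOR (registered helper stub `eqRung_core_anchor` of the crux item): the second moment of the
block velocity fluctuation under `⊗ᵢ N(u, θ𝟙)` is EXACTLY `3 θ Σ cᵢ²` — the one place where
independence (cancellation across particles) enters the equilibrium rung. -/
theorem eqRung_core_anchor : ∀ (u : V3) (θ : ℝ) (N : ℕ) (c : Fin (N + 1) → ℝ), 0 < θ → ∫⁻ v, ENNReal.ofReal (‖∑ i, c i • (v i - u)‖ ^ 2) ∂(Measure.pi fun _ : Fin (N + 1) => Literature.MathematicalPhysics.KineticTheory.gaussMeasure u θ) = ENNReal.ofReal (3 * θ * ∑ i, c i ^ 2) :=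
  fun u θ _ c hθ => lintegral_norm_eta_sq u θ c (fun v => ∑ i, c i • (v i - u)) rfl hθ

end EqRung

end

end Summit.AtomisticToContinuum.HydrodynamicLimit.Theorems.ContactBalance
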